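import Mathlib
import HarnessLib
import Literature.MathematicalPhysics.QuantumFieldTheory.ConstructiveQFTWave0
import Summits.Ventures.LatticeQCDFlow.Scaling.TunnellingLaws
import Summits.Ventures.LatticeQCDFlow.Scaling.SliceTwistWitness

/-!
# LatticeQCDFlow / Scaling — the slice-twist Markov pair: no thin-plaquette tunnelling law on a wrapping line above `2π/L` (v3.4, (C7b″), part 2 of 2)

HONEST FRAMING: exact (Metropolis-corrected) sampling algorithms for lattice gauge theory; figures
of merit are autocorrelation/cost numbers at stated couplings and volumes; no continuum-physics
claim.

THEORY-2.md §4 (C7), §5.15.  Sequel of `SliceTwistWitness.lean` (the slice twist `sliceTwist L`: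
`2π/L`-thin plaquettes, flux charge `-1`, hence outside the `ε`-sector of the trivial configuration
for `ε ≤ 2`, while agreeing with it off the wrapping line `sliceLinks L`).

* **§4 threshold necessity** (`exists_invariant_pair_sliceLinks`, `not_thinPlaquetteLaw_sliceLinks`):
  the two-point measure `μ = ½(δ_1 + δ_{sliceTwist L})` and the deterministic swap kernel
  `1 ↔ sliceTwist L` form a `μ`-INVARIANT Markov pair that moves only the `L` links of
  `sliceLinks L`, with `(μ ⊗ κ){ε-sector changes} = 1` (`0 < ε ≤ 2`) and
  `μ{∃ p, dist(U_p, 1) ≥ c} = 0` for every `c > 2π/L`.  Hence NO inequality of the shape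
  `(μ ⊗ κ){sector ≠} ≤ C·μ{some c-thick plaquette}` — the shape of every metric tunnelling law of
  this directory, e.g. `Lattice.compProd_sector_ne_le_of_box` with `C = 2` for solid boxes — holds
  for the update set `sliceLinks L` with a threshold `c > 2π/L`, for any constant `C`: thresholds
  uniform in `L` are impossible for update sets whose size grows with `L`.

SCOPE (honest reading).  (i) This does NOT exclude a law for `sliceLinks L` with a smaller,
`L`-dependent threshold (`c ≲ 1/L²` follows from the sharp `U(1)` patch law of `FluxTunnelling.lean`).
(ii) Nothing here is a statement about the Wilson measure: the invariant pair is a two-point measure.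
For Wilson targets the price of the slice twist is its action `βL(1 - cos(2π/L)) ≃ 2π²β/L`, small
when `L ≫ β` — the regime of winding / instanton-insertion moves [cite: AlbandeaEtAl2021, §3–§4,
acceptance of the winding step growing with the winding size `L_w`, `⟨ΔS⟩ ≃ βπ²/(2L_w)`], which the
one-plaquette tunnelling price does not and cannot cover.
-/

noncomputable section

namespace Summit.Ventures.LatticeQCDFlow.Theory2.Lattice.Flux

open MeasureTheory ProbabilityTheory Metric Set Filter Topology Real
open scoped ENNReal
open Literature.MathematicalPhysics.QuantumFieldTheory Literature.MathematicalPhysics.QuantumLattice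
/-! ## §4. Threshold necessity: an invariant Markov pair on the wrapping line defeating every `c > 2π/L` -/

section Pair

variable {L : ℕ} [NeZero L]

open Classical in
/-- The two-state swap `1 ↔ sliceTwist L`, the identity elsewhere. [folklore] -/
def swapConfig (L : ℕ) [NeZero L] (W : GaugeConfig 2 L Circle) : GaugeConfig 2 L Circle :=
  if W = 1 then sliceTwist L else if W = sliceTwist L then 1 else W

/-- The swap sends `1` to the slice twist. [folklore] -/
theorem swapConfig_one : swapConfig L 1 = sliceTwist L := if_pos rfl

/-- The swap sends the slice twist to `1`. [folklore] -/
theorem swapConfig_sliceTwist (hL : 3 ≤ L) : swapConfig L (sliceTwist L) = 1 := by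
  rw [swapConfig, if_neg (sliceTwist_ne_one hL), if_pos rfl]

/-- The swap fixes every other configuration. [folklore] -/
theorem swapConfig_of_ne {W : GaugeConfig 2 L Circle} (h1 : W ≠ 1) (h2 : W ≠ sliceTwist L) :
    swapConfig L W = W := by
  rw [swapConfig, if_neg h1, if_neg h2]

/-- The swap moves only links of the wrapping line. [folklore] -/
theorem eq_swapConfig_of_not_mem (hL : 3 ≤ L) (W : GaugeConfig 2 L Circle) {e : Edge 2 L}
    (he : e ∉ sliceLinks L) : W e = swapConfig L W e := by
  by_cases h1 : W = 1
  · subst h1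
    rw [swapConfig_one, sliceTwist_apply_of_not_mem he]; rfl
  · by_cases h2 : W = sliceTwist L
    · subst h2
      rw [swapConfig_sliceTwist hL, sliceTwist_apply_of_not_mem he]; rfl
    · rw [swapConfig_of_ne h1 h2]

/-- The swap is measurable (piecewise constant / identity on measurable pieces). [folklore] -/
theorem measurable_swapConfig : Measurable (swapConfig L) := by
  unfold swapConfig
  refine Measurable.ite ?_ measurable_const (Measurable.ite ?_ measurable_const measurable_id)
  · rw [Set.setOf_eq_eq_singleton]; exact measurableSet_singleton _
  · rw [Set.setOf_eq_eq_singleton]; exact measurableSet_singleton _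

/-- The deterministic swap kernel. [folklore] -/
def swapKernel (L : ℕ) [NeZero L] :
    Kernel (GaugeConfig 2 L Circle) (GaugeConfig 2 L Circle) :=
  Kernel.deterministic (swapConfig L) measurable_swapConfig

/-- The swap kernel is Markov. [folklore] -/
instance isMarkovKernel_swapKernel : IsMarkovKernel (swapKernel L) := by
  unfold swapKernel; infer_instance

/-- The two-point measure `½(δ_1 + δ_{sliceTwist})`. [folklore] -/
def pairMeasure (L : ℕ) [NeZero L] : Measure (GaugeConfig 2 L Circle) :=
  (2 : ℝ≥0∞)⁻¹ • (Measure.dirac 1 + Measure.dirac (sliceTwist L))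

/-- The two-point measure is a probability measure. [folklore] -/
instance isProbabilityMeasure_pairMeasure : IsProbabilityMeasure (pairMeasure L) :=
  ⟨by rw [pairMeasure, Measure.smul_apply, Measure.add_apply, measure_univ, measure_univ,
    smul_eq_mul, one_add_one_eq_two, ENNReal.inv_mul_cancel two_ne_zero (by simp)]⟩

/-- The swap kernel at the two atoms. [folklore] -/
theorem swapKernel_apply_one : swapKernel L 1 = Measure.dirac (sliceTwist L) := by
  rw [swapKernel, Kernel.deterministic_apply, swapConfig_one]

/-- The swap kernel at the two atoms. [folklore] -/
theorem swapKernel_apply_sliceTwist (hL : 3 ≤ L) :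
    swapKernel L (sliceTwist L) = Measure.dirac 1 := by
  rw [swapKernel, Kernel.deterministic_apply, swapConfig_sliceTwist hL]

/-- **Invariance**: the swap exchanges two atoms of equal mass. [folklore] -/
theorem swapKernel_invariant (hL : 3 ≤ L) : (swapKernel L).Invariant (pairMeasure L) := by
  show (pairMeasure L).bind (swapKernel L) = pairMeasure L
  ext s hs
  rw [Measure.bind_apply hs (Kernel.measurable _).aemeasurable, pairMeasure,
    lintegral_smul_measure, lintegral_add_measure, lintegral_dirac, lintegral_dirac,
    swapKernel_apply_one, swapKernel_apply_sliceTwist hL, Measure.smul_apply, Measure.add_apply,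
    add_comm]

/-- The swap pair moves only links of the wrapping line, almost surely. [folklore] -/
theorem ae_pair_eq_off_sliceLinks (hL : 3 ≤ L) :
    ∀ᵐ q ∂(pairMeasure L ⊗ₘ swapKernel L), ∀ e ∉ sliceLinks L, q.1 e = q.2 e := by
  have hRm : MeasurableSet {q : GaugeConfig 2 L Circle × GaugeConfig 2 L Circle |
      ∀ e ∉ sliceLinks L, q.1 e = q.2 e} := by
    have hc : IsClosed {q : GaugeConfig 2 L Circle × GaugeConfig 2 L Circle |
        ∀ e ∉ sliceLinks L, q.1 e = q.2 e} := by
      simp only [Set.setOf_forall]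
      exact isClosed_iInter fun e => isClosed_iInter fun _ =>
        isClosed_eq ((continuous_apply e).comp continuous_fst)
          ((continuous_apply e).comp continuous_snd)
    exact hc.measurableSet
  refine Tunnelling.ae_compProd_of_forall
    (R := fun U U' : GaugeConfig 2 L Circle => ∀ e ∉ sliceLinks L, U e = U' e)
    (pairMeasure L) (swapKernel L) hRm fun W => ?_
  rw [swapKernel, Kernel.deterministic_apply, ae_dirac_eq, Filter.eventually_pure]
  exact fun e he => eq_swapConfig_of_not_mem hL W he

/-- The two-point measure sees no `c`-thick plaquette, `c > 2π/L`. [folklore] -/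
theorem pairMeasure_thick_eq_zero {c : ℝ} (hc : 2 * π / L < c) :
    pairMeasure L {U | ∃ p : Plaquette 2 L,
      c ≤ dist (plaquetteHolonomy U p.1 p.2.1.1 p.2.1.2) 1} = 0 := by
  have hc0 : 0 < c := lt_of_le_of_lt (by positivity) hc
  have h1 : (1 : GaugeConfig 2 L Circle) ∉ {U : GaugeConfig 2 L Circle | ∃ p : Plaquette 2 L,
      c ≤ dist (plaquetteHolonomy U p.1 p.2.1.1 p.2.1.2) 1} := by
    rintro ⟨p, hp⟩
    rw [plaquetteHolonomy_one', dist_self] at hp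
    linarith
  have h2 : sliceTwist L ∉ {U : GaugeConfig 2 L Circle | ∃ p : Plaquette 2 L,
      c ≤ dist (plaquetteHolonomy U p.1 p.2.1.1 p.2.1.2) 1} := by
    rintro ⟨p, hp⟩
    linarith [dist_plaquetteHolonomy_sliceTwist_le (L := L) p]
  rw [pairMeasure, Measure.smul_apply, Measure.add_apply, Measure.dirac_apply, Measure.dirac_apply,
    Set.indicator_of_notMem h1, Set.indicator_of_notMem h2, add_zero, smul_zero]

/-- The pair puts full mass on the two ordered atom pairs. [folklore] -/
theorem compProd_pair_atoms (hL : 3 ≤ L) :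
    (pairMeasure L ⊗ₘ swapKernel L)
      {((1 : GaugeConfig 2 L Circle), sliceTwist L), (sliceTwist L, 1)} = 1 := by
  have hS : MeasurableSet
      ({((1 : GaugeConfig 2 L Circle), sliceTwist L), (sliceTwist L, 1)} :
        Set (GaugeConfig 2 L Circle × GaugeConfig 2 L Circle)) :=
    (measurableSet_singleton _).insert _
  have hm1 : sliceTwist L ∈ Prod.mk (1 : GaugeConfig 2 L Circle) ⁻¹'
      ({((1 : GaugeConfig 2 L Circle), sliceTwist L), (sliceTwist L, 1)} :
        Set (GaugeConfig 2 L Circle × GaugeConfig 2 L Circle)) := by simp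
  have hm2 : (1 : GaugeConfig 2 L Circle) ∈ Prod.mk (sliceTwist L) ⁻¹'
      ({((1 : GaugeConfig 2 L Circle), sliceTwist L), (sliceTwist L, 1)} :
        Set (GaugeConfig 2 L Circle × GaugeConfig 2 L Circle)) := by simp
  rw [pairMeasure, Measure.compProd_smul_left, Measure.compProd_add_left, Measure.smul_apply,
    Measure.add_apply, Measure.dirac_compProd_apply hS, Measure.dirac_compProd_apply hS,
    swapKernel_apply_one, swapKernel_apply_sliceTwist hL, Measure.dirac_apply_of_mem hm1,
    Measure.dirac_apply_of_mem hm2, smul_eq_mul, one_add_one_eq_two,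
    ENNReal.inv_mul_cancel two_ne_zero (by simp)]

/-- **Threshold necessity on a wrapping line (the witness).**  For `3 ≤ L`, `c > 2π/L` and
`0 < ε ≤ 2` there is a probability measure `μ` and a `μ`-invariant Markov kernel `κ` on `U(1)`
configurations of the `L × L` torus that moves only the links of `sliceLinks L`, never sees a
`c`-thick plaquette, and changes the `ε`-sector with probability one. [folklore] -/
theorem exists_invariant_pair_sliceLinks (hL : 3 ≤ L) {c ε : ℝ} (hc : 2 * π / L < c)
    (hε0 : 0 < ε) (hε2 : ε ≤ 2) :
    ∃ (μ : Measure (GaugeConfig 2 L Circle))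
      (κ : Kernel (GaugeConfig 2 L Circle) (GaugeConfig 2 L Circle)),
      IsProbabilityMeasure μ ∧ IsMarkovKernel κ ∧ κ.Invariant μ ∧
      (∀ᵐ q ∂(μ ⊗ₘ κ), ∀ e ∉ sliceLinks L, q.1 e = q.2 e) ∧
      μ {U | ∃ p : Plaquette 2 L, c ≤ dist (plaquetteHolonomy U p.1 p.2.1.1 p.2.1.2) 1} = 0 ∧
      (μ ⊗ₘ κ) {q | connectedComponentIn
            {W : GaugeConfig 2 L Circle | ∀ p : Plaquette 2 L,
              dist (plaquetteHolonomy W p.1 p.2.1.1 p.2.1.2) 1 < ε} q.1 ≠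
          connectedComponentIn
            {W : GaugeConfig 2 L Circle | ∀ p : Plaquette 2 L,
              dist (plaquetteHolonomy W p.1 p.2.1.1 p.2.1.2) 1 < ε} q.2} = 1 := by
  refine ⟨pairMeasure L, swapKernel L, inferInstance, inferInstance, swapKernel_invariant hL,
    ae_pair_eq_off_sliceLinks hL, pairMeasure_thick_eq_zero hc, ?_⟩
  apply le_antisymm prob_le_one
  calc (1 : ℝ≥0∞) = (pairMeasure L ⊗ₘ swapKernel L)
        {((1 : GaugeConfig 2 L Circle), sliceTwist L), (sliceTwist L, 1)} :=
        (compProd_pair_atoms hL).symm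
    _ ≤ _ := measure_mono ?_
  intro q hq
  simp only [Set.mem_insert_iff, Set.mem_singleton_iff] at hq
  rcases hq with rfl | rfl
  · exact connectedComponentIn_one_ne_sliceTwist hL hε0 hε2
  · exact (connectedComponentIn_one_ne_sliceTwist hL hε0 hε2).symm

/-- **No thin-plaquette law on a wrapping line above `2π/L`.**  For `3 ≤ L`, `c > 2π/L`,
`0 < ε ≤ 2` and ANY constant `C`, the inequality
`(μ ⊗ κ){ε-sector changes} ≤ C · μ{∃ p, dist(U_p, 1) ≥ c}` fails for some `μ`-invariant Markov pair
moving only `sliceLinks L` — in contrast with the box law `Lattice.compProd_sector_ne_le_of_box`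
(`C = 2`, update set a solid box, threshold `c·2·4^{2l-4} ≤ ρ`). [folklore] -/
theorem not_thinPlaquetteLaw_sliceLinks (hL : 3 ≤ L) {c ε : ℝ} (hc : 2 * π / L < c)
    (hε0 : 0 < ε) (hε2 : ε ≤ 2) (C : ℝ≥0∞) :
    ¬ ∀ (μ : Measure (GaugeConfig 2 L Circle)) [IsProbabilityMeasure μ]
        (κ : Kernel (GaugeConfig 2 L Circle) (GaugeConfig 2 L Circle)) [IsMarkovKernel κ],
        κ.Invariant μ → (∀ᵐ q ∂(μ ⊗ₘ κ), ∀ e ∉ sliceLinks L, q.1 e = q.2 e) →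
        (μ ⊗ₘ κ) {q | connectedComponentIn
              {W : GaugeConfig 2 L Circle | ∀ p : Plaquette 2 L,
                dist (plaquetteHolonomy W p.1 p.2.1.1 p.2.1.2) 1 < ε} q.1 ≠
            connectedComponentIn
              {W : GaugeConfig 2 L Circle | ∀ p : Plaquette 2 L,
                dist (plaquetteHolonomy W p.1 p.2.1.1 p.2.1.2) 1 < ε} q.2} ≤
          C * μ {U | ∃ p : Plaquette 2 L, c ≤ dist (plaquetteHolonomy U p.1 p.2.1.1 p.2.1.2) 1} := by
  intro hlaw
  obtain ⟨μ, κ, hμ, hκ, hinv, hmove, hthick, hone⟩ := exists_invariant_pair_sliceLinks hL hc hε0 hε2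
  haveI := hμ
  haveI := hκ
  have h := hlaw μ κ hinv hmove
  rw [hone, hthick, mul_zero] at h
  exact one_ne_zero (le_zero_iff.mp h)

end Pair

end Summit.Ventures.LatticeQCDFlow.Theory2.Lattice.Flux
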